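import Summits.RiemannHypothesis.RiemannHypothesis.Theorems.IntegerScrewCensusFastCheckB

/-!
# Route `IntegerScrew` — kernel checker for the census DUAL certificates (1): data, the dual matrix, the term packs

The `lo` halves `¬ ManifestCert n (1/10) lo` of the census brackets (`CensusBracketsRefPassed`,
`Theorems/ScrewManifestCertDefs.lean`) are refuted-side statements: the census supplies (sos-dualcert/v1,
HOME/sos/census/engine-B/ddcone/cells/M…-T…-dd/dualcert.json, rh-explicit-sos-eng-2) a matrix
`Y = Σ_c y_c P_c + ε I` (row/sign patterns `P_c`, dyadic `y_c ≥ 0`) which is a DUAL CERTIFICATE in the sense of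
`Manifest.DualCert` (`Theorems/ScrewManifestCertDual.lean`): `Y ∈ DD*`, `⟨J, Y⟩ ≥ 0`, `⟨S_{n+1}, Y⟩ < 0` and
`Q_Y(t) := t²⟨A_t, Y⟩ ≥ 0` for every `t ∈ [1/10, lo]`; `dualCert_sound` then excludes every manifest certificate.
This file is the STATIC part of a kernel checker for such data (design HOME/sos/CENSUS-KERNEL-IMPORT-engA.md §5,
revised «S′» by sos-eng-1 gen14): the integer matrix `Z = 2^61·Y` from the pattern literal, the exact tests `Z ∈ DD*`,
`⟨J,Z⟩ ≥ 0`, the bracket test `⟨S,Z⟩ < 0` from the scaled u-table digits (`IntegerScrewCensusUTabDigits`) and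
`CL ≤ 2^162 ζ(2,¼) ≤ CH`, and the cell-independent TERM PACKS of the continuum check: `Q_Z(t) = C0 + Σ_f A_f cos(t f)` over the
node frequencies `x_a = log(a+2)` (`A = −2·rowsum`) and the pair frequencies `x_a − x_b` (`A = 2 Z_ab`), each term carrying the
Kronecker-packed Taylor weights `⌊φ_f^k 2^{k+E} D!/(k! 2^{52k})⌋`, `k ≤ D` (`φ_f = 2^52·f̃`, `f̃` from the log table), SIGNED by
the amplitude (the cell sums are integers; digits are extracted after a balanced offset).
Sequel: `IntegerScrewCensusDualWalk` (per-cell Taylor models and the adaptive walk).  Pure arithmetic; RH-free; nothing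
here bears on the truth of RH.
-/

set_option linter.dupNamespace false
set_option autoImplicit false

namespace Summit.RiemannHypothesis.RiemannHypothesis.Theorems.IntegerScrew.Manifest.Fast

open Literature.Analysis.ValidatedNumerics Literature.Analysis.ValidatedNumerics.Numerics
open Literature.Analysis.ValidatedNumerics.KroneckerDot

/-! ### Parameters of the dual checker -/

/-- Taylor order `D` of the cell models. -/
def DG : ℕ := 40
/-- Extra precision bits `E` of the Taylor weights. -/
def EB : ℕ := 16
/-- Resolution bits `R` of the walk (`τ ∈ 2^{-R} ℕ`). -/
def RB : ℕ := 20
/-- `M = 2^R`. -/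
def MR : ℕ := 2 ^ 20
/-- Slot width (bits) of the packed Taylor weights. -/
def SW : ℕ := 424
/-- Slot base `2^SW`. -/
def SWB : ℕ := 2 ^ 424

/-! ### The dual matrix `Z = 2^61 Y` from the pattern literal -/

/-- The signed multiplier vector of one pattern `(bits, y)`: entry `b` is `+y` if bit `b` of `bits` is set (sign `+`),
else `−y`; length `n`. -/
def patVec (n bits y : ℕ) : List ℤ := (List.range n).map fun b => if Nat.testBit bits b then (y : ℤ) else -(y : ℤ)

/-- Entrywise sum of two integer lists (the longer tail is kept). -/
def addZ : List ℤ → List ℤ → List ℤ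
  | x :: xs, y :: ys => (x + y) :: addZ xs ys
  | [], ys => ys
  | xs, [] => xs

/-- `V_m = Σ_{c : m_c = m} y_c σ_c` (length `n`) and `D_m = Σ_{c : m_c = m} y_c`, for the patterns of row `m`. -/
def rowAgg (n m : ℕ) : List (ℕ × ℕ × ℕ) → List ℤ × ℕ
  | [] => ((List.range n).map fun _ => 0, 0)
  | (m', bits, y) :: ps =>
    let r := rowAgg n m ps
    if m' = m then (addZ (patVec n bits y) r.1, r.2 + y) else r

/-- All rows `m = 0 … n−1` of `(V_m, D_m)`. -/
def aggRows (n : ℕ) (pats : List (ℕ × ℕ × ℕ)) : List (List ℤ × ℕ) := (List.range n).map fun m => rowAgg n m pats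

/-- Row `a` of `Z = 2^61·Y`: `Z_ab = −(V_a[b] + V_b[a])` for `b ≠ a`, `Z_aa = 2 D_a + 2 ε'`
(`Y = Σ_c y_c P_c + ε I`, `P_c = E_mm − ½ Σ_{j≠m} σ_j (E_mj + E_jm)`, `y' = 2^60 y`, `ε' = 2^60 ε`); arguments: the row
`V_a`, the column `(V_b[a])_b`, and the running index `b`. -/
def zRow (epsN a Da : ℕ) : List ℤ → List ℤ → ℕ → List ℤ
  | v :: vs, w :: ws, b => (if b = a then (((2 * Da + 2 * epsN : ℕ) : ℤ)) else -(v + w)) :: zRow epsN a Da vs ws (b + 1)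
  | _, _, _ => []

/-- Column `c` of a list of rows (missing entries `0`). -/
def colZ (V : List (List ℤ)) (c : ℕ) : List ℤ := V.map fun row => row.getD c 0

/-- The matrix `Z` as a list of rows. -/
def zMatrix (n epsN : ℕ) (pats : List (ℕ × ℕ × ℕ)) : List (List ℤ) :=
  let agg := aggRows n pats
  let V := agg.map (·.1)
  (List.range n).map fun a => zRow epsN a ((agg.getD a ([], 0)).2) (V.getD a []) (colZ V a) 0

/-- Sum of an integer list. -/
def sumZ : List ℤ → ℤ
  | [] => 0
  | x :: xs => x + sumZ xs

/-- The diagonal `[Z_aa]_a`. -/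
def diagZ (Z : List (List ℤ)) : List ℤ := (List.range Z.length).map fun a => (Z.getD a []).getD a 0

/-- One row of the `DD*` test: `2|Z_ab| ≤ Z_aa + Z_bb` for all `b` (row entries zipped with the diagonal). -/
def ddRowCheck (zaa : ℤ) : List ℤ → List ℤ → Bool
  | z :: zs, d :: ds => decide (2 * |z| ≤ zaa + d) && ddRowCheck zaa zs ds
  | [], [] => true
  | _, _ => false

/-- `Z ∈ DD*`: `Z_aa ≥ 0` and `2|Z_ab| ≤ Z_aa + Z_bb` (rows against the diagonal list). -/
def ddDualGo (diag : List ℤ) : List (List ℤ) → List ℤ → Bool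
  | zr :: zrs, d :: ds => decide (0 ≤ d) && ddRowCheck d zr diag && ddDualGo diag zrs ds
  | [], [] => true
  | _, _ => false

/-- `Z ∈ DD*`. -/
def ddDualCheck (Z : List (List ℤ)) : Bool := ddDualGo (diagZ Z) Z (diagZ Z)

/-- `Z` is symmetric and square: row `a` equals column `a`, all rows of length `n`. -/
def symmCheck (Z : List (List ℤ)) : Bool :=
  ((List.range Z.length).all fun a => decide (Z.getD a [] = colZ Z a)) && (Z.all fun row => decide (row.length = Z.length))

/-- `⟨J, Z⟩ = Σ_ab Z_ab`. -/
def onesPair (Z : List (List ℤ)) : ℤ := sumZ (Z.map sumZ)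

/-- `C0 = Σ_ab Z_ab + Σ_a Z_aa` (the constant of `Q_Z`). -/
def constQ (Z : List (List ℤ)) : ℤ := onesPair Z + sumZ (diagZ Z)

/-! ### The bracket test `⟨S_{n+1}, Z⟩ < 0` -/

/-- Upper bound of `Σ_{b<a} Z_ab · (2^164 S_ab)` for one row: `S_ab ≤ (CH + ua₂ + ub₂ − uab₁ − OZ)/2^164` for `Z_ab ≥ 0`,
`S_ab ≥ (CL + ua₁ + ub₁ − uab₂ − OZ)/2^164` for `Z_ab < 0` (`ua = digits of u(a,1)`, read from the u-table rows). -/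
def sRowUpper (CL CH : ℕ) (ua : ℕ × ℕ) : List ℤ → List (ℕ × ℕ) → List (ℕ × ℕ) → ℤ
  | z :: zs, ub :: ubs, uab :: uabs =>
    (if 0 ≤ z then z * (((CH + ua.2 + ub.2 : ℕ) : ℤ) - ((uab.1 + OZ : ℕ) : ℤ))
      else z * (((CL + ua.1 + ub.1 : ℕ) : ℤ) - ((uab.2 + OZ : ℕ) : ℤ))) + sRowUpper CL CH ua zs ubs uabs
  | _, _, _ => 0

/-- Upper bound of `2^164 ⟨S, Z⟩ = Σ_a Z_aa 2^164 S_aa + 2 Σ_{a>b} Z_ab 2^164 S_ab`: rows `a = 0 … n−1` against the u-table rows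
`a + 2` (entry `1` = `u(a+2, 1)`, entries from `2` = `u(a+2, b+2)`); `u1s` = the list of the `u(b+2,1)` digits. -/
def sPairUpper (CL CH : ℕ) : List (List ℤ) → List (List (ℕ × ℕ)) → List (ℕ × ℕ) → ℕ → ℤ
  | zr :: zrs, urow :: urows, u1s, a =>
    let ua := urow.getD 1 (0, 0)
    let zaa := zr.getD a 0
    zaa * (((2 * CH + 2 * ua.2 : ℕ) : ℤ) - ((2 * OZ : ℕ) : ℤ)) +
      2 * sRowUpper CL CH ua (zr.take a) u1s (urow.drop 2) + sPairUpper CL CH zrs urows (u1s ++ [ua]) (a + 1)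
  | _, _, _, _ => 0

/-! ### Term data: node frequencies and pair frequencies with packed Taylor weights -/

/-- The per-order constants `(2^{k+E} D!/k!, 52k)`, `k = 0 … D`. -/
def kConsts (D E : ℕ) : List (ℕ × ℕ) := (List.range (D + 1)).map fun k => (2 ^ (k + E) * Nat.factorial D / Nat.factorial k, 52 * k)

/-- The Taylor weight digits `⌊φ^k c_k / 2^{s_k}⌋` along the constant list (running power `pw = φ^k`). -/
def wDigits (φ : ℕ) : List (ℕ × ℕ) → ℕ → List ℕ
  | [], _ => []
  | (c, s) :: rest, pw => Nat.shiftRight (Nat.mul pw c) s :: wDigits φ rest (Nat.mul pw φ)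

/-- The weight pack `Σ_k W_k 2^{SW·k}` of a frequency `φ` (`W_k = ⌊φ^k 2^{k+E} D!/(k! 2^{52k})⌋ ≈ 2^E D! (2φ/2^52)^k/k!`). -/
def wPack (cs : List (ℕ × ℕ)) (φ : ℕ) : ℕ := packN SWB (wDigits φ cs 1)

/-- Static data of node `a`: the sparse lower row `[(gap, Ω_ab)]_{b<a, Z_ab ≠ 0}` with the SIGNED pair packs
`Ω_ab = 2 Z_ab · wPack(φ_a − φ_b)` (gaps between consecutive `b`), and the signed node pack `Ω_a = A_a · 2^52 · wPack(φ_a)`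
(`A_a = −2·rowsum_a`). -/
structure NodeD where
  /-- sparse lower row: `(gap, Ω_ab)` -/
  low : List (ℕ × ℤ)
  /-- node pack `A_a · 2^52 · wPack φ_a` -/
  nom : ℤ

/-- The sparse lower row of node `a` from its `Z` row prefix and the node `φ`'s (`φ_ab = φ_a − φ_b`), with the running gap. -/
def lowRowD (cs : List (ℕ × ℕ)) (φa : ℕ) : List ℤ → List ℕ → ℕ → List (ℕ × ℤ)
  | z :: zs, φb :: φs, gap =>
    if z = 0 then lowRowD cs φa zs φs (gap + 1)
    else (gap, 2 * z * (wPack cs (φa - φb) : ℕ)) :: lowRowD cs φa zs φs 0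
  | _, _, _ => []

/-- The node data list from `Z`, the node `φ`'s (`φ_a = 16·L_{a+2}`) and the constants. -/
def nodeData (cs : List (ℕ × ℕ)) (Z : List (List ℤ)) (φs : List ℕ) : List NodeD :=
  (List.range Z.length).map fun a =>
    ⟨lowRowD cs (φs.getD a 0) ((Z.getD a []).take a) φs 0, -2 * sumZ (Z.getD a []) * (SCL * wPack cs (φs.getD a 0) : ℕ)⟩

/-- `Σ_{b<a} |A_ab|` and `Σ_{b<a} |A_ab| (φ_a − φ_b + 32)³` for the lower part of one row (`A_ab = 2 Z_ab`). -/
def ampRow (φa : ℕ) : List ℤ → List ℕ → ℕ × ℕ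
  | z :: zs, φb :: φs =>
    let r := ampRow φa zs φs
    (r.1 + 2 * z.natAbs, r.2 + 2 * z.natAbs * (φa - φb + 32) ^ 3)
  | _, _ => (0, 0)

/-- `Σ_f |A_f|` (`Z`-scale) and `Σ_f |A_f| (φ_f + 32)³` (for the third-derivative bound; `2^52 f ≤ φ_f + 32`), over the
node terms (`A_a = −2·rowsum_a`, `φ_a`) and the pair terms (`A_ab = 2 Z_ab`, `φ_a − φ_b`, `b < a`). -/
def ampSums (Z : List (List ℤ)) (φs : List ℕ) : ℕ × ℕ :=
  let n := Z.length
  let rows := (List.range n).map fun a =>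
    let zr := Z.getD a []
    let φa := φs.getD a 0
    let An := 2 * (sumZ zr).natAbs
    let pr := ampRow φa (zr.take a) φs
    (An + pr.1, An * (φa + 32) ^ 3 + pr.2)
  (sumN (rows.map (·.1)), sumN (rows.map (·.2)))

/-- The largest `|Z_ab|`. -/
def maxAbsZ (Z : List (List ℤ)) : ℕ := (Z.map fun row => (row.map Int.natAbs).foldr max 0).foldr max 0

end Summit.RiemannHypothesis.RiemannHypothesis.Theorems.IntegerScrew.Manifest.Fast
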